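/-
Copyright (c) 2026 the pub-hodgecm-mathlib formalisation cell (harness21).  Prover seat hodgecm-mathlib-K2E1-p12 (g5), Track B ∕ K2-LIT, h413 = `stmt-HodgeConjecture-24833`,
R90-TF section S8 «ContSpec-n½», sub-socket (R)′ OF RECORD (S8 dealer R90-CS-plan (g3), S8-R174 (1)): ★ p863731's (R)′ instantiated at the SOCKET FRAME of B ED. 7 :337 with
`hSCAT` fed by ★ p863697 and `hSCAL` fed by the J-S8-SCAL input rows — leaving visible ONE open-row list shared with ★ (V) assembly p863385.
-/
import Summits.HodgeConjecture.HodgeConjecture.Theorems.R90S8ResGMidBlockMSRoadOfLettersU3            -- ★ p863731 (this seat): `roadData_of_tubeLetters` (+ ★ p863518 `ctPackage_of_scalarRoad`, ★ p863422 `opRoadPackage_of_letters`, ★ p863331 spine, ★ p862884)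
import Summits.HodgeConjecture.HodgeConjecture.Theorems.R90S8ResGMidBlockScatteringOfRecordU3         -- ★ p863697 (K2E1-p13): `exists_hSCAT_of_factorisation` (hSCAT composed, Euler route), `integrable_restrict_mul_conj_of_bounded`
import Summits.HodgeConjecture.HodgeConjecture.Theorems.R90S8ResGMidBlockNeBotAssemblyU3              -- ★ p863385 (K2E2-p12): the (V) bill's rows (currency) and F5's side letters `isUnitary_bcηInv_mul`, `bcηInv_mul_posRealIdele`, `heckeChar_one_*`; brings ★ F5
import Summits.HodgeConjecture.HodgeConjecture.Theorems.K2E1ChiConstantTermFactorisationContinuedU3    -- ★ p863561 (R90-CS-p03 (a-8)): `eventually_factorisation_of_unfolded` (`hfac` from the unfolding rows)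
import Summits.HodgeConjecture.HodgeConjecture.Theorems.K2E1ChiConstantTermHolomorphicCMThree          -- ★ p863620 (K2E1-p10): `differentiableOn_middleCoefficient_slitPlane_cm_three` (`hψa` from `hEd hE4 hEbd`)
import Summits.HodgeConjecture.HodgeConjecture.Theorems.K2E1SphericalEisensteinResidueConstantCMThreeOfLetters  -- ★ `exists_analyticAt_eventuallyEq_mul_sub_of_tendsto` (the removable singularity `d₀ = (z − 3∕2)·qc`)
import HarnessLib

/-!
# S8 sub-socket (R)′ OF RECORD — `R90S8ResGMidBlockLeResidualOfRecordU3`: THE MIDDLE BLOCK IS RESIDUAL, AT THE SOCKET FRAME, OVER THE ONE OPEN-ROW LIST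

Track B ∕ R90-TF, crux h413 = `stmt-HodgeConjecture-24833`, route `HCCMUnconditional`; cell `hodgecm-mathlib`, S8 «ContSpec-n½», sub-socket (R) `sock_S8_res_midBlock_le_residual` ((R)′, B ED. 7
:337).  THEOREMS ONLY (no `def`∕`instance`∕`notation`, no named-fact hypothesis, no `sorry`, default heartbeats); lane `--supports … --as helper`; CLOSES NO SOCKET.  ★ p863731 made (R)′
«★ modulo {hDISC, hCONT, hSCAT, hSCAL}» as CLOSED letters; this file OPENS the socket frame (binders `L μ 𝔓 h𝔓 (Nonempty 𝔓.ι) μω hμu hquad ξ` of :337 verbatim, plus the Borel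
structures of `G(𝔸)` and `𝔸_L^×`) and FEEDS `hSCAT` (★ p863697 `exists_hSCAT_of_factorisation`, Euler route; Gram integrability DISCHARGED by ★ `integrable_restrict_mul_conj_of_bounded`;
the scalar pole datum `d₀` DISCHARGED by ★ F5 `exists_residue_at_threeHalves_cm_three` + ★ `exists_analyticAt_eventuallyEq_mul_sub_of_tendsto`) and `hSCAL` (§1, at the (a-7) model
`φt z g := Ag g z ∕ A z`: ★ `eventually_factorisation_of_unfolded` for `hfac`, ★ `differentiableOn_middleCoefficient_slitPlane_cm_three` for `hψa`) BY NAME, so that (R)′ and ★ (V)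
assembly p863385 converge on ONE open-row list.  THE HONEST STRUCTURAL POINT: (V) binds ONE witness generator; (R)′ bounds `resGMidBlock = closure ⨆ atoms`, so every
generator-dependent row is ∀-QUANTIFIED over D1's clause names and the NORMALISED Heisenberg package (same ROW SHAPES as (V), not the same binders); the character-level F5 rows
`hS hurφ hT′ hurη q qc P hqcq hPcd hqa A hA hsrc hA32` + `cS hq` are bound ONCE ((V) :303–:309 VERBATIM).  ROWS NOT IN (V)'s BILL (FLAG ④, the Siegel-tail profile, ★ p863083's
currency): measurability ∕ left-`B(F)` ∕ left-`N(𝔸)`-invariance of `g ↦ Ag g (3∕2)`; and on the hSCAT side the Euler junction `qc_j = qc·r_j` near `3∕2`, the pole ledger «`P′` real», `hreal`.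
* §1 **`scalPackage_of_inputs`** — one generator: LAYER-2 rows `hEd hE4 hEbd`, F5 rows + residue row `hρ`, unfolding rows `cS hq Ag hAg hM hψ2` at the DEF-FREE middle coefficient
  `ψ_z(g) := ((Ec z)_B(g) − φ(g)·H(g)^z) ∕ H(g)^{2−z}`, profile rows ⊢ ★ p863518's `hSCAL` body VERBATIM.
* §2 HEAD **`res_midBlock_le_residual_of_record`** — :337's body at the opened frame, over {`hDISC` (L1, ★ p863331's `hadm` bytes), `hCONT` (per generator, normalised package),
  `hEXP` (`hE4 hEbd` per generator), the F5 block (once), `hSCALrows` (per generator), `hSCATrows` (per generator: scattering basis `φ′`, tube coordinates `hqφ` in ★ p863697's bytes,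
  continued coordinates on `P′ᶜ`, «`P′` real», Euler junction `r hr hfac⃗`, `hreal` on the closed formula of `wc`)}; proof = ★ p863731's spine at `(ν 𝓕)⁻¹ • ν`.
HONEST LABEL: HC_CM is proved only modulo the 7 printed citations (2 remaining named inputs: hLiu418 = `stmt-HodgeConjecture-24832`, h413 = `stmt-HodgeConjecture-24833`) until
rung 0 closes; REL ≠ ★ ≠ BUILT; composition, not payment: this file asserts no named fact, is conditional by construction on the rows it names, and closes no socket; count-neutral.

## References
* [MoeglinWaldspurger1995] C. Mœglin, J.-L. Waldspurger, *Spectral Decomposition and Eisenstein Series* (1995), I.2.18, II.1.7, IV.1.9–IV.1.11, IV.2.3, IV.3.12 (a), V.3.13.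
* [Langlands1976] R. P. Langlands, *On the Functional Equations Satisfied by Eisenstein Series*, LNM 544 (1976), §7 and Appendix.
* [Rogawski1990] J. D. Rogawski, *Automorphic Representations of Unitary Groups in Three Variables* (1990), §12.1 p. 171, §13.9 p. 229 (ii).
* [BernsteinLapid2019] J. Bernstein, E. Lapid, *On the meromorphic continuation of Eisenstein series*, J. AMS 37 (2024), §4.
-/

set_option autoImplicit false
set_option linter.dupNamespace false  -- the mandated namespace `…HodgeConjecture.HodgeConjecture.R90.S8` (LEAD #1 L1) repeats the summit's segment

noncomputable section

open MeasureTheory Measure NumberField IsDedekindDomain Set Filter Topology ContRepresentation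
open scoped ENNReal NNReal ComplexConjugate InnerProductSpace Topology
open Literature.NumberTheory Literature.NumberTheory.Automorphic Literature.NumberTheory.Automorphic.UnitaryGroup Literature.NumberTheory.GaloisRepresentations AdelicGroupData
open Literature.NumberTheory.Automorphic.Arthur2013.Leaves.TECR Literature.NumberTheory.Rogawski1990 Literature.NumberTheory.LFunctions
open Summit.HodgeConjecture.HodgeConjecture.Cruxes.H413.K2E1BorelEisensteinU Summit.HodgeConjecture.HodgeConjecture.Cruxes.H413.K2E1CharacterEisensteinU2Defs
open Summit.HodgeConjecture.HodgeConjecture.Cruxes.H413.K2E1CharacterEisensteinU3PairDefs Summit.HodgeConjecture.HodgeConjecture.Cruxes.H413.K2E1ChiSectionSpaceU3PairDefs Summit.HodgeConjecture.HodgeConjecture.Cruxes.H413.K2E1BLBorelSpacesU2Defs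
open Summit.HodgeConjecture.HodgeConjecture.Cruxes.H413.K2E1CuspidalSpectrumUnitary (residualSubspace)
open Summit.HodgeConjecture.HodgeConjecture.Cruxes.H413.K2E1ChiConstantTermFactorisationContinuedU3 (eventually_factorisation_of_unfolded)
open Summit.HodgeConjecture.HodgeConjecture.Cruxes.H413.K2E1ChiConstantTermHolomorphicCMThree (differentiableOn_middleCoefficient_slitPlane_cm_three)
open Summit.HodgeConjecture.HodgeConjecture.Cruxes.H413.K2E1ChiScatteringMiddlePoleU3 (exists_residue_at_threeHalves_cm_three)
open Summit.HodgeConjecture.HodgeConjecture.Cruxes.H413.K2E1SphericalEisensteinResidueConstantCMThreeOfLetters (exists_analyticAt_eventuallyEq_mul_sub_of_tendsto)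
open Summit.HodgeConjecture.HodgeConjecture.Cruxes.H413.R90S8ResGMidBlockScatteringOfRecordU3 (exists_hSCAT_of_factorisation integrable_restrict_mul_conj_of_bounded)

namespace Summit.HodgeConjecture.HodgeConjecture.R90.S8

variable (L : Type) [Field L] [NumberField L] [IsCMField L] [MeasurableSpace (quasiSplit (↥(maximalRealSubfield L)) L (IsCMField.complexConj L) 3).Adelic] [BorelSpace (quasiSplit (↥(maximalRealSubfield L)) L (IsCMField.complexConj L) 3).Adelic]

/-- **§1. ★ p863518's `hSCAL` PACKAGE OF ONE GENERATOR FROM THE J-S8-SCAL INPUT ROWS.**  Data: the section `φ`, the continued family `Ec` with singular set `Sp`, a Heisenberg package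
`(ν, 𝓕)`.  Rows: LAYER-2 `hEd hE4 hEbd` ((V) (i)); the F5 scalar rows `q qc P hqcq hPcd hqa`, the residue row `hρ : (z − 3∕2)·qc z → ρ` (★ F5), `A hA hA32` ((V) (iii)); the unfolding rows
`cS`, `hq : q = A·cS` on `{2<Re}`, translate amplitudes `Ag` holomorphic on `{1<Re}` with the uniform bound `‖Ag g (3∕2)‖ ≤ M`, `hψ2 : ψ_z(g) = Ag g z·cS z` on `{2<Re}` at the def-free
`ψ_z(g) := ((Ec z)_B(g) − φ(g)·H(g)^z) ∕ H(g)^{2−z}` (★ p863561's inputs; NO `Ag 1 = A` row — (R)′ needs no non-vanishing `g₀`); the profile rows `hAgm hAgB hAgN` (FLAG ④).  Conclusion: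
★ p863518's `hSCAL` body — `∃ qc φt` with (c1) `(Ec z)_B = φ·H^z + qc z·φt z·H^{2−z}` near `3∕2` (★ `eventually_factorisation_of_unfolded`, `hψa` by ★
`differentiableOn_middleCoefficient_slitPlane_cm_three`, `H(g) > 0` ★ `borelHeight_pos`), (c2) `ρ`, (c3) continuity of `z ↦ Ag g z ∕ A z` at `3∕2` and (c7) the bound `M ∕ ‖A(3∕2)‖` (pattern
of ★ p863512 `normalisedSection_letters`), (c4)–(c6) from the profile rows. [cite: MoeglinWaldspurger1995, II.1.7, IV.1.11] [cite: Langlands1976, §7] -/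
theorem scalPackage_of_inputs (φ : (quasiSplit (↥(maximalRealSubfield L)) L (IsCMField.complexConj L) 3).Adelic → ℂ) (Ec : ℂ → (quasiSplit (↥(maximalRealSubfield L)) L (IsCMField.complexConj L) 3).Adelic → ℂ) (Sp : Finset ℂ)
    (hEd : ∀ g, DifferentiableOn ℂ (fun z => Ec z g) ({z : ℂ | 1 < z.re} \ (↑Sp : Set ℂ)))
    (hE4 : ∀ z ∈ ({z : ℂ | 1 < z.re} \ (↑Sp : Set ℂ)), Continuous (Ec z))
    (hEbd : ∀ z₁ ∈ ({z : ℂ | 1 < z.re} \ (↑Sp : Set ℂ)), ∀ K : Set (quasiSplit (↥(maximalRealSubfield L)) L (IsCMField.complexConj L) 3).Adelic, IsCompact K → ∃ V ∈ 𝓝 z₁, ∃ M : ℝ, ∀ z ∈ V, ∀ g ∈ K, ‖Ec z g‖ ≤ M)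
    (ν : Measure ↥(adelicUnipotent (↥(maximalRealSubfield L)) L (IsCMField.complexConj L) 3)) [ν.IsHaarMeasure] {𝓕 : Set ↥(adelicUnipotent (↥(maximalRealSubfield L)) L (IsCMField.complexConj L) 3)} (h𝓕N : IsFundamentalDomain ↥(rationalUnipotent (↥(maximalRealSubfield L)) L (IsCMField.complexConj L) 3) 𝓕 ν) (h𝓕c : IsCompact (closure 𝓕))
    (q qc : ℂ → ℂ) {P : Set ℂ} (hqcq : ∀ z : ℂ, 2 < z.re → qc z = q z) (hPcd : ∀ z₀ : ℂ, ∀ᶠ s in 𝓝[≠] z₀, s ∉ P) (hqa : ∀ z : ℂ, z ∉ P → AnalyticAt ℂ qc z)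
    {ρ : ℂ} (hρ : Tendsto (fun z : ℂ => (z - ((3 : ℂ) / 2)) * qc z) (𝓝[≠] ((3 : ℂ) / 2)) (𝓝 ρ))
    (A : ℂ → ℂ) (hA : DifferentiableOn ℂ A {z : ℂ | 1 < z.re}) (hA32 : A (3 / 2) ≠ 0)
    (cS : ℂ → ℂ) (hq : ∀ z : ℂ, 2 < z.re → q z = A z * cS z)
    (Ag : (quasiSplit (↥(maximalRealSubfield L)) L (IsCMField.complexConj L) 3).Adelic → ℂ → ℂ) (hAg : ∀ g, DifferentiableOn ℂ (Ag g) {z : ℂ | 1 < z.re}) {M : ℝ} (hM : ∀ g, ‖Ag g (3 / 2)‖ ≤ M)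
    (hψ2 : ∀ z : ℂ, 2 < z.re → ∀ g : (quasiSplit (↥(maximalRealSubfield L)) L (IsCMField.complexConj L) 3).Adelic, (borelConstantTerm ν 𝓕 (Ec z) g - φ g * (((borelHeight g : ℝ≥0) : ℝ) : ℂ) ^ z) / (((borelHeight g : ℝ≥0) : ℝ) : ℂ) ^ (2 - z) = Ag g z * cS z)
    (hAgm : Measurable fun g : (quasiSplit (↥(maximalRealSubfield L)) L (IsCMField.complexConj L) 3).Adelic => Ag g ((3 : ℂ) / 2))
    (hAgB : ∀ b ∈ arithmeticBorel (↥(maximalRealSubfield L)) L (IsCMField.complexConj L) 3, ∀ x : (quasiSplit (↥(maximalRealSubfield L)) L (IsCMField.complexConj L) 3).Adelic, Ag ((b : (quasiSplit (↥(maximalRealSubfield L)) L (IsCMField.complexConj L) 3).Adelic) * x) ((3 : ℂ) / 2) = Ag x ((3 : ℂ) / 2))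
    (hAgN : ∀ (u : ↥(adelicUnipotent (↥(maximalRealSubfield L)) L (IsCMField.complexConj L) 3)) (g : (quasiSplit (↥(maximalRealSubfield L)) L (IsCMField.complexConj L) 3).Adelic), Ag ((u : (quasiSplit (↥(maximalRealSubfield L)) L (IsCMField.complexConj L) 3).Adelic) * g) ((3 : ℂ) / 2) = Ag g ((3 : ℂ) / 2)) :
    ∃ (qc : ℂ → ℂ) (φt : ℂ → (quasiSplit (↥(maximalRealSubfield L)) L (IsCMField.complexConj L) 3).Adelic → ℂ),
        (∀ᶠ z in 𝓝[≠] ((3 : ℂ) / 2), ∀ g : (quasiSplit (↥(maximalRealSubfield L)) L (IsCMField.complexConj L) 3).Adelic,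
          borelConstantTerm ν 𝓕 (Ec z) g = φ g * (((borelHeight g : ℝ≥0) : ℝ) : ℂ) ^ z + qc z * φt z g * (((borelHeight g : ℝ≥0) : ℝ) : ℂ) ^ (2 - z)) ∧
        (∃ ρ : ℂ, Tendsto (fun z : ℂ => (z - ((3 : ℂ) / 2)) * qc z) (𝓝[≠] ((3 : ℂ) / 2)) (𝓝 ρ)) ∧
        (∀ g : (quasiSplit (↥(maximalRealSubfield L)) L (IsCMField.complexConj L) 3).Adelic, ContinuousAt (fun z => φt z g) ((3 : ℂ) / 2)) ∧
        Measurable (φt ((3 : ℂ) / 2)) ∧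
        (∀ b ∈ arithmeticBorel (↥(maximalRealSubfield L)) L (IsCMField.complexConj L) 3, ∀ x : (quasiSplit (↥(maximalRealSubfield L)) L (IsCMField.complexConj L) 3).Adelic, φt ((3 : ℂ) / 2) ((b : (quasiSplit (↥(maximalRealSubfield L)) L (IsCMField.complexConj L) 3).Adelic) * x) = φt ((3 : ℂ) / 2) x) ∧
        (∀ (u : ↥(adelicUnipotent (↥(maximalRealSubfield L)) L (IsCMField.complexConj L) 3)) (g : (quasiSplit (↥(maximalRealSubfield L)) L (IsCMField.complexConj L) 3).Adelic), φt ((3 : ℂ) / 2) ((u : (quasiSplit (↥(maximalRealSubfield L)) L (IsCMField.complexConj L) 3).Adelic) * g) = φt ((3 : ℂ) / 2) g) ∧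
        ∃ C : ℝ, ∀ g : (quasiSplit (↥(maximalRealSubfield L)) L (IsCMField.complexConj L) 3).Adelic, ‖φt ((3 : ℂ) / 2) g‖ ≤ C := by
  have hpow : ∀ (g : (quasiSplit (↥(maximalRealSubfield L)) L (IsCMField.complexConj L) 3).Adelic) (w : ℂ), ((((borelHeight g : ℝ≥0) : ℝ) : ℂ) : ℂ) ^ w ≠ 0 := fun g w => by
    rw [Ne, Complex.cpow_eq_zero_iff, not_and_or]
    exact Or.inl (Complex.ofReal_ne_zero.2 (NNReal.coe_ne_zero.2 (borelHeight_pos g).ne'))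
  -- `ψ` is holomorphic on the slit plane (★ p863620), hence the factorisation near `3∕2` (★ p863561)
  have hψa := differentiableOn_middleCoefficient_slitPlane_cm_three L Ec Sp hEd hE4 hEbd ν h𝓕N h𝓕c φ
    (fun z g => (borelConstantTerm ν 𝓕 (Ec z) g - φ g * (((borelHeight g : ℝ≥0) : ℝ) : ℂ) ^ z) / (((borelHeight g : ℝ≥0) : ℝ) : ℂ) ^ (2 - z)) (fun z _ g => rfl)
  have hfac := eventually_factorisation_of_unfolded (fun z g => (borelConstantTerm ν 𝓕 (Ec z) g - φ g * (((borelHeight g : ℝ≥0) : ℝ) : ℂ) ^ z) / (((borelHeight g : ℝ≥0) : ℝ) : ℂ) ^ (2 - z)) q qc hqcq hPcd hqa A hA hA32 cS hq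
    Ag hAg hψ2 Sp hψa
  -- continuity at `3∕2` and the uniform bound of `Ag ∕ A`
  have hopen : IsOpen {z : ℂ | 1 < z.re} := isOpen_lt continuous_const Complex.continuous_re
  have hmem : ((3 : ℂ) / 2) ∈ {z : ℂ | 1 < z.re} := by
    show (1 : ℝ) < (((3 : ℂ) / 2)).re
    norm_num
  refine ⟨qc, fun z g => Ag g z / A z, ?_, ⟨ρ, hρ⟩, fun g => ?_, hAgm.div_const _, fun b hb x => ?_, fun u g => ?_, ⟨M / ‖A ((3 : ℂ) / 2)‖, fun g => ?_⟩⟩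
  · -- (c1): `(Ec z)_B = φ·H^z + ψ_z·H^{2−z}` by definition of `ψ`, and `ψ_z = qc z·(Ag ∕ A)` near `3∕2`
    filter_upwards [hfac] with z hz g
    rw [← hz g, div_mul_cancel₀ _ (hpow g (2 - z)), add_sub_cancel]
  · exact (((hAg g).differentiableAt (hopen.mem_nhds hmem)).continuousAt).div ((hA.differentiableAt (hopen.mem_nhds hmem)).continuousAt) hA32
  · simp only [hAgB b hb x]
  · simp only [hAgN u g]
  · rw [norm_div]
    exact div_le_div_of_nonneg_right (hM g) (norm_nonneg _)

/-- **§2 HEAD. (R)′ OF RECORD — `resGMidBlock ξ μω ≤ L²_res(𝔓)` AT THE SOCKET FRAME OF B ED. 7 :337, OVER THE ONE OPEN-ROW LIST.**  Binders: the socket frame `(L μ 𝔓 h𝔓 hne μω hμu hquad ξ)`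
verbatim (+ the Borel structures of `G(𝔸)`, `𝔸_L^×`); L1 `hDISC` (★ p863331's `hadm` bytes); `hCONT` per generator at every NORMALISED Heisenberg package (★ p863731's body); `hEXP`
(LAYER-2 rows `hE4 hEbd` per generator, (V) (i)); the F5 block ONCE ((V) (iii) :303–:309 verbatim) + `cS hq`; `hSCALrows` per generator (§1's unfolding + profile rows); `hSCATrows`
per generator (a scattering basis `φ′` continuous bounded, tube coordinates `hqφ` and continued coordinates `qcv` on `P′ᶜ` in ★ p863697's bytes, «`P′` real», the Euler junction
`qcv_j = qc·r_j` near `3∕2`, and `hreal` on the closed formula of `wc` ∀ `μK νI 𝓕I`).  PROOF: ★ p863731's spine at the normalised package `(ν 𝓕)⁻¹ • ν` (★ p862884 ∘ {★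
`hdisc_of_admissible`, ★ `hcuspLetters_of_operatorRoad`}); per generator ★ `roadData_of_tubeLetters` on hCONT's data and the SCAT package (★ `exists_hSCAT_of_factorisation` with
`qcs := qc`, `d₀` ★, Gram ★, `D± :=` the quarter planes ⊆ `P′ᶜ` by «`P′` real»), §1, ★ `ctPackage_of_scalarRoad`, ★ `opRoadPackage_of_letters`.
[cite: MoeglinWaldspurger1995, I.2.18, IV.1.11, IV.2.3, V.3.13] [cite: Rogawski1990, §13.9 p. 229 (ii)] [cite: Langlands1976, §7] -/
theorem res_midBlock_le_residual_of_record [MeasurableSpace (AdeleRing (𝓞 L) L)ˣ] [BorelSpace (AdeleRing (𝓞 L) L)ˣ]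
    (μ : Measure (quasiSplit (↥(maximalRealSubfield L)) L (IsCMField.complexConj L) 3).automorphicQuotient) [(quasiSplit (↥(maximalRealSubfield L)) L (IsCMField.complexConj L) 3).IsAutomorphicMeasure μ]
    (𝔓 : (quasiSplit (↥(maximalRealSubfield L)) L (IsCMField.complexConj L) 3).ParabolicUnipotentData) (h𝔓 : ∀ j : 𝔓.ι, 𝔓.radical j = adelicUnipotent (↥(maximalRealSubfield L)) L (IsCMField.complexConj L) 3) (hne : Nonempty 𝔓.ι)
    (μω : HeckeCharacter L) (hμu : μω.IsUnitary) (hquad : (∀ x : Literature.NumberTheory.GaloisRepresentations.ideleGroup ↥(maximalRealSubfield L), μω (AdeleRing.ideleBaseChange (↥(maximalRealSubfield L)) L x) = quadraticHeckeCharCM L x)) (ξ : OneDimAutRepH L)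
    -- L1 at the frame
    (hDISC : ∀ (E : Submodule ℂ (resGMidBlock L μ ξ μω).toSubmodule)
          (hE : ∀ k, ∀ x ∈ E, ((resGMidBlock L μ ξ μω).toContRep.restrict (((standardMaximalCompactGL 3 L).comap (adelicVal (↥(maximalRealSubfield L)) L (IsCMField.complexConj L) 3 ((StdForm.antidiagonal 3).over L)) : Subgroup (quasiSplit (↥(maximalRealSubfield L)) L (IsCMField.complexConj L) 3).Adelic)).subtype) k x ∈ E), FiniteDimensional ℂ E →
          (((resGMidBlock L μ ξ μω).toContRep.restrict (((standardMaximalCompactGL 3 L).comap (adelicVal (↥(maximalRealSubfield L)) L (IsCMField.complexConj L) 3 ((StdForm.antidiagonal 3).over L)) : Subgroup (quasiSplit (↥(maximalRealSubfield L)) L (IsCMField.complexConj L) 3).Adelic)).subtype).subRep E hE).IsIrreducible →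
          FiniteDimensional ℂ (Representation.homRangeSum ((resGMidBlock L μ ξ μω).toContRep.restrict (((standardMaximalCompactGL 3 L).comap (adelicVal (↥(maximalRealSubfield L)) L (IsCMField.complexConj L) 3 ((StdForm.antidiagonal 3).over L)) : Subgroup (quasiSplit (↥(maximalRealSubfield L)) L (IsCMField.complexConj L) 3).Adelic)).subtype).toRepresentation (((resGMidBlock L μ ξ μω).toContRep.restrict (((standardMaximalCompactGL 3 L).comap (adelicVal (↥(maximalRealSubfield L)) L (IsCMField.complexConj L) 3 ((StdForm.antidiagonal 3).over L)) : Subgroup (quasiSplit (↥(maximalRealSubfield L)) L (IsCMField.complexConj L) 3).Adelic)).subtype).subRep E hE)))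
    -- hCONT at the frame: per generator, every normalised Heisenberg package
    (hCONT : ∀ (K' : Subgroup (quasiSplit (↥(maximalRealSubfield L)) L (IsCMField.complexConj L) 3).Adelic) (ω : ↥K' →* ℂ)
      (φ : (quasiSplit (↥(maximalRealSubfield L)) L (IsCMField.complexConj L) 3).Adelic → ℂ) (_ : φ ∈ chiSectionSpacePair (ξ.bcη⁻¹ * ξ.bcψ⁻¹ * μω) ξ.ψ K' (ω : ↥K' → ℂ)) (_ : Continuous φ)
      (Ec : ℂ → (quasiSplit (↥(maximalRealSubfield L)) L (IsCMField.complexConj L) 3).Adelic → ℂ) (Sp : Finset ℂ) (_ : ∀ s ∈ Sp, s.im = 0 ∧ 1 < s.re ∧ s.re ≤ 2)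
      (_ : ∀ g, DifferentiableOn ℂ (fun z => Ec z g) ({z : ℂ | 1 < z.re} \ (↑Sp : Set ℂ)))
      (_ : ∀ z : ℂ, 2 < z.re → Ec z = eisensteinSeriesU (flatSectionU φ z))
      (Fp : (quasiSplit (↥(maximalRealSubfield L)) L (IsCMField.complexConj L) 3).Adelic → ℂ → ℂ) (_ : ∀ g, AnalyticAt ℂ (Fp g) ((3 : ℂ) / 2))
      (_ : ∀ g, Fp g =ᶠ[𝓝[≠] ((3 : ℂ) / 2)] fun z => (z - (3 : ℂ) / 2) * Ec z g)
      (f : (quasiSplit (↥(maximalRealSubfield L)) L (IsCMField.complexConj L) 3).L2 μ) (_ : (f : (quasiSplit (↥(maximalRealSubfield L)) L (IsCMField.complexConj L) 3).automorphicQuotient → ℂ) =ᵐ[μ] fun x => Fp (Quotient.out (x : (quasiSplit (↥(maximalRealSubfield L)) L (IsCMField.complexConj L) 3).Adelic ⧸ (quasiSplit (↥(maximalRealSubfield L)) L (IsCMField.complexConj L) 3).quotientSubgroup))⁻¹ ((3 : ℂ) / 2))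
      (ν : Measure ↥(adelicUnipotent (↥(maximalRealSubfield L)) L (IsCMField.complexConj L) 3)) (_ : ν.IsHaarMeasure) (𝓕 : Set ↥(adelicUnipotent (↥(maximalRealSubfield L)) L (IsCMField.complexConj L) 3)) (_ : IsFundamentalDomain ↥(rationalUnipotent (↥(maximalRealSubfield L)) L (IsCMField.complexConj L) 3) 𝓕 ν) (_ : IsCompact (closure 𝓕)) (_ : ν.IsInvInvariant) (_ : ν 𝓕 = 1),
      ∃ (T : ℝ≥0) (_ : 1 ≤ T) (S : Finset ℂ) (_ : ∀ s ∈ S, s.im = 0) (Fam : ℂ → (quasiSplit (↥(maximalRealSubfield L)) L (IsCMField.complexConj L) 3).L2 μ),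
        DifferentiableOn ℂ Fam ({z : ℂ | 1 < z.re} \ (↑(Sp ∪ S) : Set ℂ)) ∧
        ∀ z ∈ ({z : ℂ | 1 < z.re} \ (↑(Sp ∪ S) : Set ℂ)), ((Fam z : (quasiSplit (↥(maximalRealSubfield L)) L (IsCMField.complexConj L) 3).L2 μ) : (quasiSplit (↥(maximalRealSubfield L)) L (IsCMField.complexConj L) 3).automorphicQuotient → ℂ) =ᵐ[μ] (quasiSplit (↥(maximalRealSubfield L)) L (IsCMField.complexConj L) 3).quotFun (truncation ν 𝓕 T (Ec z)))
    -- (V) (i): the exports' LAYER-2 rows, per generator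
    (hEXP : ∀ (K' : Subgroup (quasiSplit (↥(maximalRealSubfield L)) L (IsCMField.complexConj L) 3).Adelic) (ω : ↥K' →* ℂ)
      (φ : (quasiSplit (↥(maximalRealSubfield L)) L (IsCMField.complexConj L) 3).Adelic → ℂ) (_ : φ ∈ chiSectionSpacePair (ξ.bcη⁻¹ * ξ.bcψ⁻¹ * μω) ξ.ψ K' (ω : ↥K' → ℂ)) (_ : Continuous φ)
      (Ec : ℂ → (quasiSplit (↥(maximalRealSubfield L)) L (IsCMField.complexConj L) 3).Adelic → ℂ) (Sp : Finset ℂ) (_ : ∀ s ∈ Sp, s.im = 0 ∧ 1 < s.re ∧ s.re ≤ 2)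
      (_ : ∀ g, DifferentiableOn ℂ (fun z => Ec z g) ({z : ℂ | 1 < z.re} \ (↑Sp : Set ℂ)))
      (_ : ∀ z : ℂ, 2 < z.re → Ec z = eisensteinSeriesU (flatSectionU φ z))
      (Fp : (quasiSplit (↥(maximalRealSubfield L)) L (IsCMField.complexConj L) 3).Adelic → ℂ → ℂ) (_ : ∀ g, AnalyticAt ℂ (Fp g) ((3 : ℂ) / 2))
      (_ : ∀ g, Fp g =ᶠ[𝓝[≠] ((3 : ℂ) / 2)] fun z => (z - (3 : ℂ) / 2) * Ec z g)
      (f : (quasiSplit (↥(maximalRealSubfield L)) L (IsCMField.complexConj L) 3).L2 μ) (_ : (f : (quasiSplit (↥(maximalRealSubfield L)) L (IsCMField.complexConj L) 3).automorphicQuotient → ℂ) =ᵐ[μ] fun x => Fp (Quotient.out (x : (quasiSplit (↥(maximalRealSubfield L)) L (IsCMField.complexConj L) 3).Adelic ⧸ (quasiSplit (↥(maximalRealSubfield L)) L (IsCMField.complexConj L) 3).quotientSubgroup))⁻¹ ((3 : ℂ) / 2)), (∀ z ∈ ({z : ℂ | 1 < z.re} \ (↑Sp : Set ℂ)), Continuous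 (Ec z)) ∧ (∀ z₁ ∈ ({z : ℂ | 1 < z.re} \ (↑Sp : Set ℂ)), ∀ K : Set (quasiSplit (↥(maximalRealSubfield L)) L (IsCMField.complexConj L) 3).Adelic, IsCompact K → ∃ V ∈ 𝓝 z₁, ∃ M : ℝ, ∀ z ∈ V, ∀ g ∈ K, ‖Ec z g‖ ≤ M))
    -- (V) (iii): the F5 scalar rows at `φ := ξ.bcη⁻¹ * μω`, `η := 1`, ONCE
    {S : Set (HeightOneSpectrum (𝓞 L))} {T' : Set (HeightOneSpectrum (𝓞 ↥(maximalRealSubfield L)))}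
    (hS : S.Finite) (hurφ : ∀ w ∉ S, (ξ.bcη⁻¹ * μω).IsUnramifiedAt w) (hT' : T'.Finite) (hurη : ∀ v ∉ T', (1 : HeckeCharacter ↥(maximalRealSubfield L)).IsUnramifiedAt v)
    (q qc : ℂ → ℂ) {P : Set ℂ} (hqcq : ∀ z : ℂ, 2 < z.re → qc z = q z) (hPcd : ∀ z₀ : ℂ, ∀ᶠ s in 𝓝[≠] z₀, s ∉ P) (hqa : ∀ z : ℂ, z ∉ P → AnalyticAt ℂ qc z)
    (A : ℂ → ℂ) (hA : DifferentiableOn ℂ A {z : ℂ | 1 < z.re})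
    (hsrc : ∀ z : ℂ, 2 < z.re → q z = A z *
          ((partialStandardL S (fun w => {(ξ.bcη⁻¹ * μω).valueAtUniformizer w}) (z - 1) * partialStandardL T' (fun v => {(1 : HeckeCharacter ↥(maximalRealSubfield L)).valueAtUniformizer v}) (2 * z - 2)) /
            (partialStandardL S (fun w => {(ξ.bcη⁻¹ * μω).valueAtUniformizer w}) z * partialStandardL T' (fun v => {(1 : HeckeCharacter ↥(maximalRealSubfield L)).valueAtUniformizer v}) (2 * z - 1))))
    (hA32 : A (3 / 2) ≠ 0) (cS : ℂ → ℂ) (hq : ∀ z : ℂ, 2 < z.re → q z = A z * cS z)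
    -- J-S8-SCAL: the unfolding + profile rows, per generator
    (hSCALrows : ∀ (K' : Subgroup (quasiSplit (↥(maximalRealSubfield L)) L (IsCMField.complexConj L) 3).Adelic) (ω : ↥K' →* ℂ)
      (φ : (quasiSplit (↥(maximalRealSubfield L)) L (IsCMField.complexConj L) 3).Adelic → ℂ) (_ : φ ∈ chiSectionSpacePair (ξ.bcη⁻¹ * ξ.bcψ⁻¹ * μω) ξ.ψ K' (ω : ↥K' → ℂ)) (_ : Continuous φ)
      (Ec : ℂ → (quasiSplit (↥(maximalRealSubfield L)) L (IsCMField.complexConj L) 3).Adelic → ℂ) (Sp : Finset ℂ) (_ : ∀ s ∈ Sp, s.im = 0 ∧ 1 < s.re ∧ s.re ≤ 2)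
      (_ : ∀ g, DifferentiableOn ℂ (fun z => Ec z g) ({z : ℂ | 1 < z.re} \ (↑Sp : Set ℂ)))
      (_ : ∀ z : ℂ, 2 < z.re → Ec z = eisensteinSeriesU (flatSectionU φ z))
      (Fp : (quasiSplit (↥(maximalRealSubfield L)) L (IsCMField.complexConj L) 3).Adelic → ℂ → ℂ) (_ : ∀ g, AnalyticAt ℂ (Fp g) ((3 : ℂ) / 2))
      (_ : ∀ g, Fp g =ᶠ[𝓝[≠] ((3 : ℂ) / 2)] fun z => (z - (3 : ℂ) / 2) * Ec z g)
      (f : (quasiSplit (↥(maximalRealSubfield L)) L (IsCMField.complexConj L) 3).L2 μ) (_ : (f : (quasiSplit (↥(maximalRealSubfield L)) L (IsCMField.complexConj L) 3).automorphicQuotient → ℂ) =ᵐ[μ] fun x => Fp (Quotient.out (x : (quasiSplit (↥(maximalRealSubfield L)) L (IsCMField.complexConj L) 3).Adelic ⧸ (quasiSplit (↥(maximalRealSubfield L)) L (IsCMField.complexConj L) 3).quotientSubgroup))⁻¹ ((3 : ℂ) / 2))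
      (ν : Measure ↥(adelicUnipotent (↥(maximalRealSubfield L)) L (IsCMField.complexConj L) 3)) (_ : ν.IsHaarMeasure) (𝓕 : Set ↥(adelicUnipotent (↥(maximalRealSubfield L)) L (IsCMField.complexConj L) 3)) (_ : IsFundamentalDomain ↥(rationalUnipotent (↥(maximalRealSubfield L)) L (IsCMField.complexConj L) 3) 𝓕 ν) (_ : IsCompact (closure 𝓕)) (_ : ν.IsInvInvariant) (_ : ν 𝓕 = 1),
      ∃ (Ag : (quasiSplit (↥(maximalRealSubfield L)) L (IsCMField.complexConj L) 3).Adelic → ℂ → ℂ) (M : ℝ),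
        (∀ g, DifferentiableOn ℂ (Ag g) {z : ℂ | 1 < z.re}) ∧ (∀ g, ‖Ag g (3 / 2)‖ ≤ M) ∧
        (∀ z : ℂ, 2 < z.re → ∀ g : (quasiSplit (↥(maximalRealSubfield L)) L (IsCMField.complexConj L) 3).Adelic, (borelConstantTerm ν 𝓕 (Ec z) g - φ g * (((borelHeight g : ℝ≥0) : ℝ) : ℂ) ^ z) / (((borelHeight g : ℝ≥0) : ℝ) : ℂ) ^ (2 - z) = Ag g z * cS z) ∧
        (Measurable fun g : (quasiSplit (↥(maximalRealSubfield L)) L (IsCMField.complexConj L) 3).Adelic => Ag g ((3 : ℂ) / 2)) ∧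
        (∀ b ∈ arithmeticBorel (↥(maximalRealSubfield L)) L (IsCMField.complexConj L) 3, ∀ x : (quasiSplit (↥(maximalRealSubfield L)) L (IsCMField.complexConj L) 3).Adelic, Ag ((b : (quasiSplit (↥(maximalRealSubfield L)) L (IsCMField.complexConj L) 3).Adelic) * x) ((3 : ℂ) / 2) = Ag x ((3 : ℂ) / 2)) ∧
        (∀ (u : ↥(adelicUnipotent (↥(maximalRealSubfield L)) L (IsCMField.complexConj L) 3)) (g : (quasiSplit (↥(maximalRealSubfield L)) L (IsCMField.complexConj L) 3).Adelic), Ag ((u : (quasiSplit (↥(maximalRealSubfield L)) L (IsCMField.complexConj L) 3).Adelic) * g) ((3 : ℂ) / 2) = Ag g ((3 : ℂ) / 2)))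
    -- hSCAT's rows, per generator
    (hSCATrows : ∀ (K' : Subgroup (quasiSplit (↥(maximalRealSubfield L)) L (IsCMField.complexConj L) 3).Adelic) (ω : ↥K' →* ℂ)
      (φ : (quasiSplit (↥(maximalRealSubfield L)) L (IsCMField.complexConj L) 3).Adelic → ℂ) (_ : φ ∈ chiSectionSpacePair (ξ.bcη⁻¹ * ξ.bcψ⁻¹ * μω) ξ.ψ K' (ω : ↥K' → ℂ)) (_ : Continuous φ)
      (Ec : ℂ → (quasiSplit (↥(maximalRealSubfield L)) L (IsCMField.complexConj L) 3).Adelic → ℂ) (Sp : Finset ℂ) (_ : ∀ s ∈ Sp, s.im = 0 ∧ 1 < s.re ∧ s.re ≤ 2)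
      (_ : ∀ g, DifferentiableOn ℂ (fun z => Ec z g) ({z : ℂ | 1 < z.re} \ (↑Sp : Set ℂ)))
      (_ : ∀ z : ℂ, 2 < z.re → Ec z = eisensteinSeriesU (flatSectionU φ z))
      (Fp : (quasiSplit (↥(maximalRealSubfield L)) L (IsCMField.complexConj L) 3).Adelic → ℂ → ℂ) (_ : ∀ g, AnalyticAt ℂ (Fp g) ((3 : ℂ) / 2))
      (_ : ∀ g, Fp g =ᶠ[𝓝[≠] ((3 : ℂ) / 2)] fun z => (z - (3 : ℂ) / 2) * Ec z g)
      (f : (quasiSplit (↥(maximalRealSubfield L)) L (IsCMField.complexConj L) 3).L2 μ) (_ : (f : (quasiSplit (↥(maximalRealSubfield L)) L (IsCMField.complexConj L) 3).automorphicQuotient → ℂ) =ᵐ[μ] fun x => Fp (Quotient.out (x : (quasiSplit (↥(maximalRealSubfield L)) L (IsCMField.complexConj L) 3).Adelic ⧸ (quasiSplit (↥(maximalRealSubfield L)) L (IsCMField.complexConj L) 3).quotientSubgroup))⁻¹ ((3 : ℂ) / 2))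
      (ν : Measure ↥(adelicUnipotent (↥(maximalRealSubfield L)) L (IsCMField.complexConj L) 3)) (_ : ν.IsHaarMeasure) (𝓕 : Set ↥(adelicUnipotent (↥(maximalRealSubfield L)) L (IsCMField.complexConj L) 3)) (_ : IsFundamentalDomain ↥(rationalUnipotent (↥(maximalRealSubfield L)) L (IsCMField.complexConj L) 3) 𝓕 ν) (_ : IsCompact (closure 𝓕)) (_ : ν.IsInvInvariant) (_ : ν 𝓕 = 1),
      ∃ (ι : Type) (_ : Fintype ι) (φ' : ι → (quasiSplit (↥(maximalRealSubfield L)) L (IsCMField.complexConj L) 3).Adelic → ℂ) (qv qcv : ι → ℂ → ℂ) (P' : Set ℂ) (r : ι → ℂ → ℂ),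
        (∀ j, Continuous (φ' j)) ∧ (∀ j, ∃ C : ℝ, ∀ x, ‖φ' j x‖ ≤ C) ∧
        (∀ z : ℂ, 2 < z.re → (∑ j, qv j z • φ' j) = ((((ν 𝓕).toReal⁻¹ : ℝ)) : ℂ) • (fun g : (quasiSplit (↥(maximalRealSubfield L)) L (IsCMField.complexConj L) 3).Adelic => (∫ v : ↥(adelicUnipotent (↥(maximalRealSubfield L)) L (IsCMField.complexConj L) 3), flatSectionU φ z ((quasiSplit (↥(maximalRealSubfield L)) L (IsCMField.complexConj L) 3).toAdelic (weylLongU ((IsCMField.complexConj L : L ≃ₐ[↥(maximalRealSubfield L)] L) : L →+* L) (rfl : (StdForm.antidiagonal 3).over L = (StdForm.antidiagonal 3).over L)) * ((v : (quasiSplit (↥(maximalRealSubfield L)) L (IsCMField.complexConj L) 3).Adelic) * g)) ∂ν) * (((borelHeight g : ℝ) : ℂ) ^ (z - 2)))) ∧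
        (∀ j, DifferentiableOn ℂ (qcv j) P'ᶜ) ∧ (∀ j (z : ℂ), 2 < z.re → qcv j z = qv j z) ∧ (∀ z ∈ P', z.im = 0) ∧
        (∀ j, AnalyticAt ℂ (r j) (3 / 2 : ℂ)) ∧ (∀ j, ∀ᶠ z in 𝓝[≠] ((3 / 2 : ℂ)), qcv j z = qc z * r j z) ∧
        (∀ (μK : Measure ↥((standardMaximalCompactGL 3 L).comap (adelicVal (↥(maximalRealSubfield L)) L (IsCMField.complexConj L) 3 ((StdForm.antidiagonal 3).over L)) : Subgroup (quasiSplit (↥(maximalRealSubfield L)) L (IsCMField.complexConj L) 3).Adelic)) (_ : μK.IsHaarMeasure) (νI : Measure (AdeleRing (𝓞 L) L)ˣ) (_ : νI.IsHaarMeasure) (𝓕I : Set (AdeleRing (𝓞 L) L)ˣ) (_ : IsIdeleClassDomain L 𝓕I) (wc : ℂ → ℂ),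
          (∀ z : ℂ, wc z = (∑ j, qcv j z * ∫ k, φ' j (k : (quasiSplit (↥(maximalRealSubfield L)) L (IsCMField.complexConj L) 3).Adelic) * conj (φ (k : (quasiSplit (↥(maximalRealSubfield L)) L (IsCMField.complexConj L) 3).Adelic)) ∂μK) * ∫ x in {x : (AdeleRing (𝓞 L) L)ˣ | (IdeleClassGroup.ideleNorm L x : ℝ) ≤ 1} ∩ 𝓕I, ((IdeleClassGroup.ideleNorm L x : ℝ) : ℂ) * (((reflectChar (IsCMField.complexConj L) (ξ.bcη⁻¹ * ξ.bcψ⁻¹ * μω) x : ℂˣ) : ℂ) * conj (((ξ.bcη⁻¹ * ξ.bcψ⁻¹ * μω) x : ℂˣ) : ℂ)) ∂νI) → ∀ᶠ x : ℝ in 𝓝[≠] (3 / 2 : ℝ), (wc (x : ℂ)).im = 0)) :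
    resGMidBlock L μ ξ μω ≤ residualSubspace (quasiSplit (↥(maximalRealSubfield L)) L (IsCMField.complexConj L) 3) μ 𝔓 := by
  -- the scalar residue `ρ` (★ F5) and the removable singularity `d₀ = (z − 3∕2)·qc` (★), once
  obtain ⟨ρ, hρ, -⟩ := exists_residue_at_threeHalves_cm_three L (isUnitary_bcηInv_mul L ξ hμu) (bcηInv_mul_posRealIdele L ξ μω hquad) hS hurφ
    (heckeChar_one_isUnitary ↥(maximalRealSubfield L)) (heckeChar_one_posRealIdele ↥(maximalRealSubfield L)) hT' hurη q qc hqcq hPcd hqa A hA hsrc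
  obtain ⟨d₀, hd₀, hd₀q, -⟩ := exists_analyticAt_eventuallyEq_mul_sub_of_tendsto (eventually_nhdsWithin_iff.1 (hPcd ((3 : ℂ) / 2)))
    (fun x hx => (hqa x (hx.1 hx.2)).differentiableAt.differentiableWithinAt) hρ
  -- a NORMALISED Heisenberg package (★ inhabited, rescaled by `(ν 𝓕)⁻¹` as in ★ p863731 §2)
  obtain ⟨ν, 𝓕, hν, hinv, h𝓕N, h𝓕c, h𝓕1⟩ : ∃ (ν : Measure ↥(adelicUnipotent (↥(maximalRealSubfield L)) L (IsCMField.complexConj L) 3)) (𝓕 : Set ↥(adelicUnipotent (↥(maximalRealSubfield L)) L (IsCMField.complexConj L) 3)), ν.IsHaarMeasure ∧ ν.IsInvInvariant ∧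
      IsFundamentalDomain ↥(rationalUnipotent (↥(maximalRealSubfield L)) L (IsCMField.complexConj L) 3) 𝓕 ν ∧ IsCompact (closure 𝓕) ∧ ν 𝓕 = 1 := by
    obtain ⟨ν, 𝓕, hν, -, -, h𝓕N, h𝓕c, h𝓕0, h𝓕top⟩ :=
      Summit.HodgeConjecture.HodgeConjecture.Cruxes.H413.K2E1SphericalEisensteinStructuralDataCMThree.exists_unipotent_haar_fundamentalDomain_cm_three L
    haveI := hν
    have hc : IsCMField.complexConj L * IsCMField.complexConj L = 1 := AlgEquiv.ext fun x => IsCMField.complexConj_apply_apply L x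
    haveI hν₁ : ((ν 𝓕)⁻¹ • ν).IsHaarMeasure := Measure.IsHaarMeasure.smul ν (ENNReal.inv_ne_zero.2 h𝓕top) (ENNReal.inv_ne_top.2 h𝓕0)
    exact ⟨(ν 𝓕)⁻¹ • ν, 𝓕, hν₁, Summit.HodgeConjecture.HodgeConjecture.Cruxes.H413.K2E1HeisenbergHaarU3.isInvInvariant_of_isHaarMeasure_adelicUnipotent_three hc _,
      h𝓕N.mono smul_absolutelyContinuous, h𝓕c, by rw [Measure.smul_apply, smul_eq_mul, ENNReal.inv_mul_cancel h𝓕0 h𝓕top]⟩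
  haveI := hν
  haveI := hinv
  obtain ⟨i⟩ := hne
  refine resGMidBlock_le_residualSubspace_of_disc_of_cuspLetters L μ 𝔓 ξ μω (hdisc_of_admissible L μ ξ μω hDISC)
    (hcuspLetters_of_operatorRoad L μ 𝔓 ξ μω ν h𝓕N h𝓕c i (h𝔓 i) hμu
      (fun K' ω φ hφV hφc Ec Sp hSp hhol hEis Fp hFp hFpE f hf => ?_))
  -- the rows of this generator at the normalised package
  obtain ⟨T, hT, S₁, hS₁, Fam, hFd, hFam⟩ := hCONT K' ω φ hφV hφc Ec Sp hSp hhol hEis Fp hFp hFpE f hf ν hν 𝓕 h𝓕N h𝓕c hinv h𝓕1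
  obtain ⟨hE4, hEbd⟩ := hEXP K' ω φ hφV hφc Ec Sp hSp hhol hEis Fp hFp hFpE f hf
  obtain ⟨Ag, M, hAg, hM, hψ2, hAgm, hAgB, hAgN⟩ := hSCALrows K' ω φ hφV hφc Ec Sp hSp hhol hEis Fp hFp hFpE f hf ν hν 𝓕 h𝓕N h𝓕c hinv h𝓕1
  obtain ⟨ι, hι, φ', qv, qcv, P', r, hφ'c, hφ'bd, hqφ, hqcP, hqcq', hPreal, hr, hfacv, hreal⟩ :=
    hSCATrows K' ω φ hφV hφc Ec Sp hSp hhol hEis Fp hFp hFpE f hf ν hν 𝓕 h𝓕N h𝓕c hinv h𝓕1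
  obtain ⟨Cφ, hφC⟩ := exists_bound_of_mem_chiSectionSpacePair_midBlock L ξ hμu hφV hφc
  -- hSCAT's package for every `(μ_K, ν_I, 𝓕_I)`: ★ p863697 §2 on the quarter planes (⊆ `P′ᶜ` because `P′` is real), Gram ★ §4, `hreal` the row
  have hDUPo : IsOpen {z : ℂ | 1 < z.re ∧ 0 < z.im} := (isOpen_lt continuous_const Complex.continuous_re).and (isOpen_lt continuous_const Complex.continuous_im)
  have hDLOo : IsOpen {z : ℂ | 1 < z.re ∧ z.im < 0} := (isOpen_lt continuous_const Complex.continuous_re).and (isOpen_lt Complex.continuous_im continuous_const)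
  have hscat : ∀ (μK : Measure ↥((standardMaximalCompactGL 3 L).comap (adelicVal (↥(maximalRealSubfield L)) L (IsCMField.complexConj L) 3 ((StdForm.antidiagonal 3).over L)) : Subgroup (quasiSplit (↥(maximalRealSubfield L)) L (IsCMField.complexConj L) 3).Adelic)) (_ : μK.IsHaarMeasure) (νI : Measure (AdeleRing (𝓞 L) L)ˣ) (_ : νI.IsHaarMeasure) (𝓕I : Set (AdeleRing (𝓞 L) L)ˣ) (_ : IsIdeleClassDomain L 𝓕I),
        ∃ (wc : ℂ → ℂ) (Bc : ℂ → ℂ → ℂ) (d : ℂ → ℂ),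
          DifferentiableOn ℂ wc {z : ℂ | 1 < z.re ∧ 0 < z.im} ∧ DifferentiableOn ℂ wc {z : ℂ | 1 < z.re ∧ z.im < 0} ∧ (∀ s : ℂ, 2 < s.re → wc s = ∫ x in {x : (AdeleRing (𝓞 L) L)ˣ | (IdeleClassGroup.ideleNorm L x : ℝ) ≤ 1} ∩ 𝓕I, ((IdeleClassGroup.ideleNorm L x : ℝ) : ℂ) * (((reflectChar (IsCMField.complexConj L) (ξ.bcη⁻¹ * ξ.bcψ⁻¹ * μω) x : ℂˣ) : ℂ) * conj (((ξ.bcη⁻¹ * ξ.bcψ⁻¹ * μω) x : ℂˣ) : ℂ) * (∫ k, (fun g : (quasiSplit (↥(maximalRealSubfield L)) L (IsCMField.complexConj L) 3).Adelic => (∫ v : ↥(adelicUnipotent (↥(maximalRealSubfield L)) L (IsCMField.complexConj L) 3), flatSectionU φ s ((quasiSplit (↥(maximalRealSubfield L)) L (IsCMField.complexConj L) 3).toAdelic (weylLongU ((IsCMField.complexConj L : L ≃ₐ[↥(maximalRealSubfield L)] L) : L →+* L) (rfl : (StdForm.antidiagonal 3).over L = (StdForm.antidiagonal 3).over L)) *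 ((v : (quasiSplit (↥(maximalRealSubfield L)) L (IsCMField.complexConj L) 3).Adelic) * g)) ∂ν) * ((borelHeight g : ℝ) : ℂ) ^ (s - 2)) (k : (quasiSplit (↥(maximalRealSubfield L)) L (IsCMField.complexConj L) 3).Adelic) * conj (φ (k : (quasiSplit (↥(maximalRealSubfield L)) L (IsCMField.complexConj L) 3).Adelic)) ∂μK)) ∂νI) ∧
          (∀ z' ∈ {z : ℂ | 1 < z.re ∧ 0 < z.im}, DifferentiableOn ℂ (fun z : ℂ => Bc z z') {z : ℂ | 1 < z.re ∧ 0 < z.im}) ∧ (∀ z ∈ {z : ℂ | 1 < z.re ∧ 0 < z.im}, DifferentiableOn ℂ (fun u : ℂ => Bc z (conj u)) {u : ℂ | conj u ∈ {z : ℂ | 1 < z.re ∧ 0 < z.im}}) ∧ (∀ z' ∈ {z : ℂ | 1 < z.re ∧ z.im < 0}, DifferentiableOn ℂ (fun z : ℂ => Bc z z') {z : ℂ | 1 < z.re ∧ z.im < 0}) ∧ (∀ z ∈ {z : ℂ | 1 < z.re ∧ z.im < 0}, DifferentiableOn ℂ (fun u : ℂ => Bc z (conj u)) {u : ℂ | conj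 u ∈ {z : ℂ | 1 < z.re ∧ z.im < 0}}) ∧ (∀ s s' : ℂ, 2 < s.re → 2 < s'.re → Bc s s' = (∫ x in {x : (AdeleRing (𝓞 L) L)ˣ | (IdeleClassGroup.ideleNorm L x : ℝ) ≤ 1} ∩ 𝓕I, ((IdeleClassGroup.ideleNorm L x : ℝ) : ℂ) ∂νI) * (∫ k, (fun g : (quasiSplit (↥(maximalRealSubfield L)) L (IsCMField.complexConj L) 3).Adelic => (∫ v : ↥(adelicUnipotent (↥(maximalRealSubfield L)) L (IsCMField.complexConj L) 3), flatSectionU φ s ((quasiSplit (↥(maximalRealSubfield L)) L (IsCMField.complexConj L) 3).toAdelic (weylLongU ((IsCMField.complexConj L : L ≃ₐ[↥(maximalRealSubfield L)] L) : L →+* L) (rfl : (StdForm.antidiagonal 3).over L = (StdForm.antidiagonal 3).over L)) * ((v : (quasiSplit (↥(maximalRealSubfield L)) L (IsCMField.complexConj L) 3).Adelic) * g)) ∂ν) * ((borelHeight g : ℝ) : ℂ) ^ (s - 2)) (k : (quasiSplit (↥(maximalRealSubfield L)) L (IsCMField.complexConj L) 3).Adelic) * conj ((fun g : (quasiSplit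 (↥(maximalRealSubfield L)) L (IsCMField.complexConj L) 3).Adelic => (∫ v : ↥(adelicUnipotent (↥(maximalRealSubfield L)) L (IsCMField.complexConj L) 3), flatSectionU φ s' ((quasiSplit (↥(maximalRealSubfield L)) L (IsCMField.complexConj L) 3).toAdelic (weylLongU ((IsCMField.complexConj L : L ≃ₐ[↥(maximalRealSubfield L)] L) : L →+* L) (rfl : (StdForm.antidiagonal 3).over L = (StdForm.antidiagonal 3).over L)) * ((v : (quasiSplit (↥(maximalRealSubfield L)) L (IsCMField.complexConj L) 3).Adelic) * g)) ∂ν) * ((borelHeight g : ℝ) : ℂ) ^ (s' - 2)) (k : (quasiSplit (↥(maximalRealSubfield L)) L (IsCMField.complexConj L) 3).Adelic)) ∂μK)) ∧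
          (AnalyticAt ℂ d (3 / 2 : ℂ)) ∧ (∀ᶠ z in 𝓝[≠] ((3 / 2 : ℂ)), d z = (z - 3 / 2) * wc z) ∧ (∀ᶠ x : ℝ in 𝓝[≠] (3 / 2 : ℝ), (wc (x : ℂ)).im = 0) ∧ (∃ B : ℝ, ∀ᶠ z in 𝓝[≠] ((3 / 2 : ℂ)), ‖z - 3 / 2‖ ^ 2 * ‖Bc z z‖ ≤ B) := by
    intro μK hμK νI hνI 𝓕I h𝓕I
    haveI := hμK
    obtain ⟨wc, Bc, d, h1, h2, h3, h4, h5, h6, h7, h8, h9, h10, h11, h12⟩ :=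
      exists_hSCAT_of_factorisation L μK νI 𝓕I ν h𝓕1 (ξ.bcη⁻¹ * ξ.bcψ⁻¹ * μω) φ φ' hqφ hqcP hqcq'
        hDUPo (fun z hz hP => hz.2.ne' (hPreal z hP)) hDLOo (fun z hz hP => hz.2.ne (hPreal z hP))
        (fun j => by obtain ⟨C, hC⟩ := hφ'bd j; exact integrable_restrict_mul_conj_of_bounded L μK (hφ'c j) hφc hC hφC)
        (fun j l => by obtain ⟨C, hC⟩ := hφ'bd j; obtain ⟨C', hC'⟩ := hφ'bd l; exact integrable_restrict_mul_conj_of_bounded L μK (hφ'c j) (hφ'c l) hC hC')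
        hr hd₀ hd₀q hfacv
    exact ⟨wc, Bc, d, h1, h2, h3, h4, h5, h6, h7, h8, h9, h10, hreal μK hμK νI hνI 𝓕I h𝓕I wc h12, h11⟩
  -- ROAD (★ p863731 §1), SCAL (§1), CT (★ p863518 §1), operator road (★ p863422 §1)
  obtain ⟨T', hT', D, σ₀, Fam', hDo, hDc, hDsub, hFd', hσ₀, hσD, hD32, hFam', hMS⟩ :=
    roadData_of_tubeLetters L μ ξ μω hμu hquad hφV hφc Ec hSp hEis ν h𝓕N h𝓕1 h𝓕c hT hS₁ Fam hFd hFam hscat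
  obtain ⟨qc', φt, hfacCT, ⟨ρ', hρ'⟩, hφt, hφtm, hφtB, hφtN, C, hφtbd⟩ :=
    scalPackage_of_inputs L φ Ec Sp hhol hE4 hEbd ν h𝓕N h𝓕c q qc hqcq hPcd hqa hρ A hA hA32 cS hq Ag hAg hM hψ2 hAgm hAgB hAgN
  obtain ⟨φ₀, ψ, ρψ, hE3, hψ, hψm, hψB, hψN, K, hψK⟩ :=
    ctPackage_of_scalarRoad L φ Ec Sp ν 𝓕 qc' φt hfacCT hρ' hφt hφtm hφtB hφtN hφtbd
  exact opRoadPackage_of_letters L μ 𝔓 ξ μω i (h𝔓 i) hφV Ec hSp hhol hEis Fp hFp hFpE f hf ν h𝓕N h𝓕c hT' Fam' hDo hDc hDsub hFd' hσ₀ hσD hD32 hFam' hMS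
    φ₀ ψ ρψ hE3 hψ hψm hψB hψN hψK

end Summit.HodgeConjecture.HodgeConjecture.R90.S8

end
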